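import Literature.Analysis.FluidPDE.NormalisedPressureDischarge
import Literature.Analysis.FluidPDE.TaoForcedNormalisedPressure
import HarnessLib

/-!
# Probe bounds for the force terms of Tao's forced pressure normalisation (Lemma 4.1 (i))

Analysis/FluidPDE file (cell `pub/ns-blowup`, seat `ns-blowup-lit` g8; PATH B of the `E–C`
endpoint, LIT-DOSSIER §41/§43–§44). WHAT THIS IS NOT: not a statement about Navier–Stokes —
elementary `L²` bookkeeping (Cauchy–Schwarz, Tonelli) for the two FORCE terms of the probe
identity in the proof of Tao 2011, Lemma 4.1 (i) (= arXiv:1108.1165 Lemma 25 (i), pp. 14–15),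
the a.e. form `tao2011_forced_pressure_normalisation_ae` (`TaoForcedNormalisedPressure`).

Tao's argument tests the time-integrated momentum equation against the unit-mass radial bump
`χ_R(· - x₀)` (`probeBump R`, `HarmonicProbe`) and lets `R → ∞`; with a force `f` two terms
appear that the tree's unforced discharge (`NormalisedPressureDischarge`,
`exists_bound_probe_*`) does not have, and both must be bounded LINEARLY in `‖f(t)‖_{L²}`
(only `∫₀ᵀ ‖f(t)‖_{L²} dt < ∞` is available for finite-energy data):

* the direct force term `∫ ⟪g(y), χ_R(y - x₀) a⟫ dy` (`exists_bound_probe_force`):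
  `|…| ≤ K ‖g‖_{L²} R⁻¹` for `R ≥ 1` (Cauchy–Schwarz on the ball `B̄(x₀, 2R)`:
  `|χ_R| ≤ (m R³)⁻¹`, `vol^{1/2} = O(R^{3/2})`, so in fact `O(R^{-3/2})`);
* the force-potential term `∫ ∂ₐχ_R(z) (Δ⁻¹∇·g)(x₀ - z) dz` (`exists_bound_probe_forcePotential`):
  `|…| ≤ K ‖g‖_{L²} R⁻¹` for `R ≥ 1`. Proof (Tao: "`R⁻³ ∫ fᵢ (∇Δ⁻¹∂ᵢχ)(x/R)`, which is
  `O(R^{-3/2} ‖f‖_{L²})`"): `|Δ⁻¹∇·g (x)| ≤ ∫ κ(x - y)|g(y)| dy`, `κ(z) = (4π|z|²)⁻¹ = κ₁ + κ₂`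
  split at `|z| = 1` (`ForcePotentialL2Bound`: `κ₁ ∈ L¹`, `κ₂ ∈ L²`); by Tonelli the near part
  is `∫ |g(y)| P₁(x₀ - y) dy` with `P₁ = |∂ₐχ_R| ⋆ κ₁ ≤ ‖κ₁‖₁ sup|∂ₐχ_R| = O(R⁻⁴)` supported in
  `B̄(0, 2R + 1)`, hence `O(R⁻⁴ · R^{3/2} ‖g‖₂)` by Cauchy–Schwarz on that ball; the far part is
  `∫ |∂ₐχ_R(z)| (∫ κ₂(x₀ - z - y)|g(y)| dy) dz ≤ ‖∂ₐχ_R‖₁ ‖κ₂‖₂ ‖g‖₂ = O(R⁻¹ ‖g‖₂)`.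

Everything is stated for a continuous square-integrable slice `g : ℝ³ → ℝ³` (the force slices
`f(t)` of the cell's smooth finite-energy data at the good times `‖f(t)‖_{L²} < ∞`); all
integrals are handled as lower Lebesgue integrals, so no integrability of `Δ⁻¹∇·g`'s integrand
is presupposed. No definitions, no named facts.

## Mathlib / tree search

Tree: `probeBump`, `abs_probeBump_le`, `probeBump_eq_zero`, `fderiv_probeBump_apply`,
`norm_fderiv_probeBump_le`, `exists_bound_baseBump_derivs` (`HarmonicProbe`),
`volume_real_closedBall_two_mul` (`NormalisedPressureDischarge`), `forcePotential`, `forceKernel`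
(`TaoForcedNormalisedPressure`); the majorant facts `κ·1_B ∈ L¹`, `κ·1_{Bᶜ} ∈ L²` are re-proved
privately here (as in `ForcePotentialL2Bound`, whose statements assume bounded integrable slices). Mathlib: `ENNReal.lintegral_mul_le_Lp_mul_Lq`,
`lintegral_lintegral_swap`, `enorm_integral_le_lintegral_enorm`.

## References

* T. Tao, *Localisation and compactness properties of the Navier–Stokes global regularity
  problem*, Anal. PDE 6 (2013) 25–107 = arXiv:1108.1165, §4, proof of Lemma 4.1 (i)
  (arXiv Lemma 25 (i), pp. 14–15). [Tao2011]
* D. Gilbarg, N. S. Trudinger, *Elliptic Partial Differential Equations of Second Order*,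
  Springer 2001, (2.12)–(2.14). [GilbargTrudinger2001]
-/

noncomputable section

open MeasureTheory Set Filter Metric Topology Real
open scoped ENNReal NNReal RealInnerProductSpace

namespace Literature.Analysis.FluidPDE

/-! ### `L²` bookkeeping with lower integrals -/

section L2Tools

variable {g : EuclideanSpace ℝ (Fin 3) → EuclideanSpace ℝ (Fin 3)}

/-- `‖g‖_{L²} = (∫⁻ ‖g‖ₑ²)^{1/2}` (unfolding `eLpNorm` at `p = 2`). [folklore] -/
private theorem eLpNorm_two_eq_lintegral (g : EuclideanSpace ℝ (Fin 3) → EuclideanSpace ℝ (Fin 3)) :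
    eLpNorm g 2 volume = (∫⁻ y, ‖g y‖ₑ ^ (2 : ℝ)) ^ (1 / 2 : ℝ) := by
  rw [eLpNorm_eq_lintegral_rpow_enorm_toReal two_ne_zero ENNReal.ofNat_ne_top, ENNReal.toReal_ofNat]

/-- **Cauchy–Schwarz on a set**: `∫_S |g| ≤ vol(S)^{1/2} ‖g‖_{L²}` (lower integrals). [folklore] -/
private theorem setLIntegral_enorm_le_sqrt_volume_mul_eLpNorm (hg : AEStronglyMeasurable g volume)
    {S : Set (EuclideanSpace ℝ (Fin 3))} (hS : MeasurableSet S) :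
    ∫⁻ y in S, ‖g y‖ₑ ≤ volume S ^ (1 / 2 : ℝ) * eLpNorm g 2 volume := by
  have hpq : (2 : ℝ).HolderConjugate 2 := by rw [Real.holderConjugate_iff]; norm_num
  have h1 : AEMeasurable (S.indicator (1 : EuclideanSpace ℝ (Fin 3) → ℝ≥0∞)) volume :=
    (measurable_one.indicator hS).aemeasurable
  have h2 : AEMeasurable (fun y => ‖g y‖ₑ) volume := hg.enorm
  have h := ENNReal.lintegral_mul_le_Lp_mul_Lq volume hpq h1 h2
  have e1 : ∫⁻ y in S, ‖g y‖ₑ = ∫⁻ y, (S.indicator (1 : EuclideanSpace ℝ (Fin 3) → ℝ≥0∞) * fun y => ‖g y‖ₑ) y := by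
    rw [← lintegral_indicator hS]
    refine lintegral_congr fun y => ?_
    by_cases hy : y ∈ S <;> simp [hy]
  have e2 : ∫⁻ y, S.indicator (1 : EuclideanSpace ℝ (Fin 3) → ℝ≥0∞) y ^ (2 : ℝ) = volume S := by
    rw [← lintegral_indicator_one hS]
    refine lintegral_congr fun y => ?_
    by_cases hy : y ∈ S <;> simp [hy]
  rw [e1]
  refine h.trans (le_of_eq ?_)
  rw [e2, eLpNorm_two_eq_lintegral g]

/-- `‖∫ φ‖ₑ ≤ ∫⁻ ‖φ‖ₑ` and `|r| ≤ b` from `‖r‖ₑ ≤ ofReal b`: the real-valued read-out of an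
`ℝ≥0∞` bound. [folklore] -/
private theorem abs_le_of_enorm_le {r b : ℝ} (hb : 0 ≤ b) (h : ‖r‖ₑ ≤ ENNReal.ofReal b) : |r| ≤ b := by
  have h' : ENNReal.ofReal |r| ≤ ENNReal.ofReal b := by
    rwa [← Real.enorm_eq_ofReal_abs]
  exact (ENNReal.ofReal_le_ofReal_iff hb).1 h'

end L2Tools

/-! ### The majorant kernel `κ(z) = (4π|z|²)⁻¹`, near part in `L¹`, far part in `L²` -/

section Majorant

/-- The majorant kernel `κ(z) = (4π|z|²)⁻¹` of `∇Γ` is nonnegative. [folklore] -/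
private theorem kap_nonneg (z : EuclideanSpace ℝ (Fin 3)) : 0 ≤ (4 * π * ‖z‖ ^ 2)⁻¹ := by
  positivity

/-- `κ` is measurable. [folklore] -/
private theorem measurable_kap : Measurable (fun z : EuclideanSpace ℝ (Fin 3) => (4 * π * ‖z‖ ^ 2)⁻¹) :=
  ((continuous_const.mul (continuous_norm.pow 2)).measurable).inv

/-- **Pointwise bound of the force kernel**: `|∇Γ(x - y)·g(y)| ≤ κ(x - y)|g(y)|` (Cauchy–Schwarz;
both sides vanish at `x = y`). [cite: GilbargTrudinger2001, (2.14)] -/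
private theorem norm_forceKernel_sub_le (g : EuclideanSpace ℝ (Fin 3) → EuclideanSpace ℝ (Fin 3))
    (x y : EuclideanSpace ℝ (Fin 3)) :
    ‖forceKernel (x - y) (g y)‖ ≤ (4 * π * ‖x - y‖ ^ 2)⁻¹ * ‖g y‖ := by
  rw [Real.norm_eq_abs, forceKernel_eq_fin3]
  set z := x - y
  rcases eq_or_ne z 0 with hz | hz
  · simp [hz]
  have hz' : 0 < ‖z‖ := norm_pos_iff.2 hz
  rw [abs_div, abs_of_pos (by positivity : 0 < 4 * π * ‖z‖ ^ 3), div_le_iff₀ (by positivity)]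
  calc |⟪z, g y⟫| ≤ ‖z‖ * ‖g y‖ := abs_real_inner_le_norm z (g y)
    _ = (4 * π * ‖z‖ ^ 2)⁻¹ * ‖g y‖ * (4 * π * ‖z‖ ^ 3) := by field_simp

/-- **The near part `κ·1_{B(0,1)}` is integrable** (`|z|⁻²`, `2 < 3`). [cite: GilbargTrudinger2001, (2.14)] -/
private theorem integrable_kap_near :
    Integrable ((ball (0 : EuclideanSpace ℝ (Fin 3)) 1).indicator (fun z : EuclideanSpace ℝ (Fin 3) => (4 * π * ‖z‖ ^ 2)⁻¹)) := by
  rw [integrable_indicator_iff measurableSet_ball]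
  refine integrableOn_ball_of_norm_le_rpow (by rw [finrank_euclideanSpace_fin]; norm_num)
    (C := (4 * π)⁻¹) (α := 2) (by rw [finrank_euclideanSpace_fin]; norm_num)
    (Eventually.of_forall fun z => ?_) measurable_kap.aestronglyMeasurable
  rw [Real.norm_of_nonneg (kap_nonneg z), mul_inv, Real.rpow_neg (norm_nonneg _), Real.rpow_two]

/-- **The far part `κ·1_{B(0,1)ᶜ}` is square integrable** (`|z|⁻⁴ ≤ 16 (1+|z|)⁻⁴` for `|z| ≥ 1`,
`4 > 3`). [cite: GilbargTrudinger2001, (2.14)] -/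
private theorem memLp_kap_far :
    MemLp ((ball (0 : EuclideanSpace ℝ (Fin 3)) 1)ᶜ.indicator (fun z : EuclideanSpace ℝ (Fin 3) => (4 * π * ‖z‖ ^ 2)⁻¹)) 2 volume := by
  have hmeas : AEStronglyMeasurable ((ball (0 : EuclideanSpace ℝ (Fin 3)) 1)ᶜ.indicator (fun z : EuclideanSpace ℝ (Fin 3) => (4 * π * ‖z‖ ^ 2)⁻¹)) volume :=
    (measurable_kap.indicator measurableSet_ball.compl).aestronglyMeasurable
  rw [memLp_two_iff_integrable_sq hmeas]
  have hint : Integrable (fun z : EuclideanSpace ℝ (Fin 3) => 16 * (4 * π)⁻¹ ^ 2 * (1 + ‖z‖) ^ (-(4 : ℝ))) volume :=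
    (integrable_one_add_norm (by rw [finrank_euclideanSpace_fin]; norm_num)).const_mul _
  refine hint.mono' ((hmeas.aemeasurable.pow_const 2).aestronglyMeasurable)
    (Eventually.of_forall fun z => ?_)
  rw [Real.norm_of_nonneg (sq_nonneg _)]
  by_cases hz : z ∈ (ball (0 : EuclideanSpace ℝ (Fin 3)) 1)ᶜ
  · rw [indicator_of_mem hz]
    rw [mem_compl_iff, mem_ball_zero_iff, not_lt] at hz
    have h2 : (1 + ‖z‖) ^ (-(4 : ℝ)) = ((1 + ‖z‖) ^ 4)⁻¹ := by
      rw [Real.rpow_neg (by positivity), ← Real.rpow_natCast]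
      norm_num
    have h4 : (1 + ‖z‖) ^ 4 ≤ 16 * ‖z‖ ^ 4 := by
      have h3 : 1 + ‖z‖ ≤ 2 * ‖z‖ := by linarith
      calc (1 + ‖z‖) ^ 4 ≤ (2 * ‖z‖) ^ 4 := pow_le_pow_left₀ (by positivity) h3 4
        _ = 16 * ‖z‖ ^ 4 := by ring
    have h5 : (‖z‖ ^ 4)⁻¹ ≤ 16 * ((1 + ‖z‖) ^ 4)⁻¹ := by
      rw [← div_eq_mul_inv, le_div_iff₀ (by positivity)]
      calc (‖z‖ ^ 4)⁻¹ * (1 + ‖z‖) ^ 4 ≤ (‖z‖ ^ 4)⁻¹ * (16 * ‖z‖ ^ 4) := by gcongr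
        _ = 16 := by field_simp
    have e : ((4 * π * ‖z‖ ^ 2)⁻¹) ^ 2 = (4 * π)⁻¹ ^ 2 * (‖z‖ ^ 4)⁻¹ := by
      rw [mul_inv, mul_pow, inv_pow, inv_pow, ← pow_mul]
    rw [h2, e]
    calc (4 * π)⁻¹ ^ 2 * (‖z‖ ^ 4)⁻¹ ≤ (4 * π)⁻¹ ^ 2 * (16 * ((1 + ‖z‖) ^ 4)⁻¹) := by gcongr
      _ = 16 * (4 * π)⁻¹ ^ 2 * ((1 + ‖z‖) ^ 4)⁻¹ := by ring
  · rw [indicator_of_notMem hz]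
    simp only [ne_eq, OfNat.ofNat_ne_zero, not_false_eq_true, zero_pow]
    positivity

/-- The far part is bounded: `κ·1_{B(0,1)ᶜ} ≤ (4π)⁻¹`. [folklore] -/
private theorem kap_far_le (z : EuclideanSpace ℝ (Fin 3)) :
    (ball (0 : EuclideanSpace ℝ (Fin 3)) 1)ᶜ.indicator (fun z : EuclideanSpace ℝ (Fin 3) => (4 * π * ‖z‖ ^ 2)⁻¹) z ≤ (4 * π)⁻¹ := by
  by_cases hz : z ∈ (ball (0 : EuclideanSpace ℝ (Fin 3)) 1)ᶜ
  · rw [indicator_of_mem hz]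
    rw [mem_compl_iff, mem_ball_zero_iff, not_lt] at hz
    rw [mul_inv]
    refine mul_le_of_le_one_right (by positivity) ?_
    rw [inv_le_one_iff₀]
    exact Or.inr (one_le_pow₀ hz)
  · rw [indicator_of_notMem hz]; positivity

/-- The split `κ = κ·1_{B} + κ·1_{Bᶜ}`. [folklore] -/
private theorem kap_eq_near_add_far (z : EuclideanSpace ℝ (Fin 3)) :
    (4 * π * ‖z‖ ^ 2)⁻¹ = (ball (0 : EuclideanSpace ℝ (Fin 3)) 1).indicator (fun z : EuclideanSpace ℝ (Fin 3) => (4 * π * ‖z‖ ^ 2)⁻¹) z +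
      (ball (0 : EuclideanSpace ℝ (Fin 3)) 1)ᶜ.indicator (fun z : EuclideanSpace ℝ (Fin 3) => (4 * π * ‖z‖ ^ 2)⁻¹) z := by
  rw [← Pi.add_apply, Set.indicator_self_add_compl]

end Majorant

/-! ### The direct force term `∫ ⟪g, χ_R(· - x₀) a⟫` -/

section ForceTerm

/-- **Bound for the force probe term** (Tao 2011, §4, proof of Lemma 4.1 (i): the contribution of
`f` to `∫∫ (∂ₜu …) χ_R`, "`O(R^{-3/2})` by the finite energy of the data"): for `g : ℝ³ → ℝ³`
continuous with `‖g‖_{L²} ≤ F`, every `R ≥ 1` and `x₀`,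
`|∫ ⟪g(y), χ_R(y - x₀) a⟫ dy| ≤ K F R⁻¹` (`|χ_R| ≤ (m R³)⁻¹` on `B̄(x₀, 2R)`, zero outside, and
Cauchy–Schwarz on that ball). [cite: Tao2011, §4, proof of Lemma 4.1 (i)] -/
theorem exists_bound_probe_force (a : EuclideanSpace ℝ (Fin 3)) : ∃ K, 0 ≤ K ∧
    ∀ (g : EuclideanSpace ℝ (Fin 3) → EuclideanSpace ℝ (Fin 3)) (F : ℝ), Continuous g → 0 ≤ F →
    eLpNorm g 2 volume ≤ ENNReal.ofReal F → ∀ (R : ℝ), 1 ≤ R → ∀ x₀ : EuclideanSpace ℝ (Fin 3),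
      |∫ y, ⟪g y, probeBump R (y - x₀) • a⟫| ≤ K * F * R⁻¹ := by
  set m := baseBumpMass (EuclideanSpace ℝ (Fin 3)) with hm
  have hm0 : 0 < m := baseBumpMass_pos
  set V₁ := (volume : Measure (EuclideanSpace ℝ (Fin 3))).real (closedBall (0 : EuclideanSpace ℝ (Fin 3)) 1) with hV₁
  have hV₁0 : 0 ≤ V₁ := measureReal_nonneg
  refine ⟨‖a‖ * m⁻¹ * Real.sqrt (8 * V₁), by positivity, ?_⟩
  intro g F hg hF hgF R hR1 x₀
  have hR : 0 < R := one_pos.trans_le hR1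
  have hd : Module.finrank ℝ (EuclideanSpace ℝ (Fin 3)) = 3 := finrank_euclideanSpace_fin
  set B := closedBall x₀ (2 * R) with hB
  have hBm : MeasurableSet B := measurableSet_closedBall
  -- pointwise: `|⟪g y, χ_R(y - x₀) a⟫| ≤ ‖a‖ (m R³)⁻¹ 1_B(y) ‖g y‖`
  have hχ : ∀ y, |probeBump R (y - x₀)| ≤ (m * R ^ 3)⁻¹ := fun y => by
    have := abs_probeBump_le (E := EuclideanSpace ℝ (Fin 3)) hR (y - x₀); rwa [hd] at this
  have hχ0 : ∀ y, y ∉ B → probeBump R (y - x₀) = 0 := fun y hy => by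
    refine probeBump_eq_zero hR ?_
    rw [hB, mem_closedBall, dist_eq_norm, not_le] at hy
    exact hy.le
  have hpt : ∀ y, ‖⟪g y, probeBump R (y - x₀) • a⟫‖ₑ ≤
      ENNReal.ofReal (‖a‖ * (m * R ^ 3)⁻¹) * B.indicator (fun y => ‖g y‖ₑ) y := by
    intro y
    by_cases hy : y ∈ B
    · rw [indicator_of_mem hy, Real.enorm_eq_ofReal_abs, ← ofReal_norm,
        ← ENNReal.ofReal_mul (by positivity)]
      refine ENNReal.ofReal_le_ofReal ?_
      rw [inner_smul_right, abs_mul]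
      calc |probeBump R (y - x₀)| * |⟪g y, a⟫| ≤ (m * R ^ 3)⁻¹ * (‖g y‖ * ‖a‖) :=
            mul_le_mul (hχ y) (abs_real_inner_le_norm _ _) (abs_nonneg _) (by positivity)
        _ = ‖a‖ * (m * R ^ 3)⁻¹ * ‖g y‖ := by ring
    · rw [hχ0 y hy, zero_smul, inner_zero_right, enorm_zero]
      exact bot_le
  -- integrate
  have hI : ‖∫ y, ⟪g y, probeBump R (y - x₀) • a⟫‖ₑ ≤
      ENNReal.ofReal (‖a‖ * (m * R ^ 3)⁻¹) * (volume B ^ (1 / 2 : ℝ) * eLpNorm g 2 volume) := by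
    calc ‖∫ y, ⟪g y, probeBump R (y - x₀) • a⟫‖ₑ ≤ ∫⁻ y, ‖⟪g y, probeBump R (y - x₀) • a⟫‖ₑ :=
          enorm_integral_le_lintegral_enorm _
      _ ≤ ∫⁻ y, ENNReal.ofReal (‖a‖ * (m * R ^ 3)⁻¹) * B.indicator (fun y => ‖g y‖ₑ) y :=
          lintegral_mono hpt
      _ = ENNReal.ofReal (‖a‖ * (m * R ^ 3)⁻¹) * ∫⁻ y in B, ‖g y‖ₑ := by
          rw [lintegral_const_mul' _ _ ENNReal.ofReal_ne_top, lintegral_indicator hBm]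
      _ ≤ _ := by
          gcongr
          exact setLIntegral_enorm_le_sqrt_volume_mul_eLpNorm hg.aestronglyMeasurable hBm
  -- the volume of the ball and the read-out
  have hvol : volume B = ENNReal.ofReal (8 * R ^ 3 * V₁) := by
    rw [hB, ← ofReal_measureReal (measure_closedBall_lt_top).ne, volume_real_closedBall_two_mul x₀ hR.le]
  have hvol' : volume B ^ (1 / 2 : ℝ) = ENNReal.ofReal (Real.sqrt (8 * R ^ 3 * V₁)) := by
    rw [hvol, Real.sqrt_eq_rpow, ENNReal.ofReal_rpow_of_nonneg (by positivity) (by norm_num)]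
  have hgF' : eLpNorm g 2 volume ≤ ENNReal.ofReal F := hgF
  have hbound : ‖∫ y, ⟪g y, probeBump R (y - x₀) • a⟫‖ₑ ≤
      ENNReal.ofReal (‖a‖ * (m * R ^ 3)⁻¹ * (Real.sqrt (8 * R ^ 3 * V₁) * F)) := by
    refine hI.trans ?_
    rw [hvol', ENNReal.ofReal_mul (p := ‖a‖ * (m * R ^ 3)⁻¹) (by positivity),
      ENNReal.ofReal_mul (p := Real.sqrt (8 * R ^ 3 * V₁)) (by positivity)]
    gcongr
  refine (abs_le_of_enorm_le (by positivity) hbound).trans ?_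
  -- arithmetic: `(m R³)⁻¹ √(8 R³ V₁) F ≤ m⁻¹ √(8 V₁) F R⁻¹` for `R ≥ 1`
  have hsq : Real.sqrt (8 * R ^ 3 * V₁) = Real.sqrt (8 * V₁) * R * Real.sqrt R := by
    rw [show 8 * R ^ 3 * V₁ = (8 * V₁) * (R ^ 2 * R) by ring,
      Real.sqrt_mul (by positivity : (0 : ℝ) ≤ 8 * V₁),
      Real.sqrt_mul (by positivity : (0 : ℝ) ≤ R ^ 2), Real.sqrt_sq hR.le]
    ring
  have hsqrtR : Real.sqrt R ≤ R :=
    calc Real.sqrt R ≤ Real.sqrt (R ^ 2) := Real.sqrt_le_sqrt (by nlinarith)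
      _ = R := Real.sqrt_sq hR.le
  rw [hsq]
  calc ‖a‖ * (m * R ^ 3)⁻¹ * (Real.sqrt (8 * V₁) * R * Real.sqrt R * F)
      ≤ ‖a‖ * (m * R ^ 3)⁻¹ * (Real.sqrt (8 * V₁) * R * R * F) := by gcongr
    _ = ‖a‖ * m⁻¹ * Real.sqrt (8 * V₁) * F * R⁻¹ := by
        field_simp
    _ ≤ ‖a‖ * m⁻¹ * Real.sqrt (8 * V₁) * F * R⁻¹ := le_rfl

end ForceTerm

/-! ### The force-potential term `∫ ∂ₐχ_R(z) (Δ⁻¹∇·g)(x₀ - z) dz` -/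

section PotentialTerm

variable {g : EuclideanSpace ℝ (Fin 3) → EuclideanSpace ℝ (Fin 3)}

/-- `|Δ⁻¹∇·g (x)| ≤ ∫ κ(x - y)|g(y)| dy` as lower integrals (no integrability presupposed).
[cite: GilbargTrudinger2001, (2.14)] -/
private theorem enorm_forcePotential_le (g : EuclideanSpace ℝ (Fin 3) → EuclideanSpace ℝ (Fin 3))
    (x : EuclideanSpace ℝ (Fin 3)) :
    ‖forcePotential g x‖ₑ ≤ ∫⁻ y, ENNReal.ofReal ((4 * π * ‖x - y‖ ^ 2)⁻¹) * ‖g y‖ₑ := by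
  rw [forcePotential]
  refine (enorm_integral_le_lintegral_enorm _).trans (lintegral_mono fun y => ?_)
  rw [← ofReal_norm, ← ofReal_norm, ← ENNReal.ofReal_mul (kap_nonneg _)]
  exact ENNReal.ofReal_le_ofReal (norm_forceKernel_sub_le g x y)

/-- **Far part, inner Cauchy–Schwarz**: `∫ κ₂(w - y)|g(y)| dy ≤ ‖κ₂‖_{L²} ‖g‖_{L²}` for every `w`
(translation invariance of `‖κ₂(w - ·)‖_{L²}`). [folklore] -/
private theorem lintegral_kapFar_mul_le (hg : AEStronglyMeasurable g volume) (w : EuclideanSpace ℝ (Fin 3)) :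
    ∫⁻ y, ENNReal.ofReal ((ball (0 : EuclideanSpace ℝ (Fin 3)) 1)ᶜ.indicator (fun z : EuclideanSpace ℝ (Fin 3) => (4 * π * ‖z‖ ^ 2)⁻¹) (w - y)) * ‖g y‖ₑ ≤
      eLpNorm ((ball (0 : EuclideanSpace ℝ (Fin 3)) 1)ᶜ.indicator (fun z : EuclideanSpace ℝ (Fin 3) => (4 * π * ‖z‖ ^ 2)⁻¹)) 2 volume * eLpNorm g 2 volume := by
  set κ₂ := (ball (0 : EuclideanSpace ℝ (Fin 3)) 1)ᶜ.indicator (fun z : EuclideanSpace ℝ (Fin 3) => (4 * π * ‖z‖ ^ 2)⁻¹) with hκ₂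
  have hκ₂m : Measurable κ₂ := measurable_kap.indicator measurableSet_ball.compl
  have hpq : (2 : ℝ).HolderConjugate 2 := by rw [Real.holderConjugate_iff]; norm_num
  have h1 : AEMeasurable (fun y => ENNReal.ofReal (κ₂ (w - y))) volume :=
    (ENNReal.measurable_ofReal.comp (hκ₂m.comp (measurable_const.sub measurable_id))).aemeasurable
  have h := ENNReal.lintegral_mul_le_Lp_mul_Lq volume hpq h1 hg.enorm
  refine h.trans (le_of_eq ?_)
  congr 1
  · rw [eLpNorm_eq_lintegral_rpow_enorm_toReal two_ne_zero ENNReal.ofNat_ne_top, ENNReal.toReal_ofNat]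
    congr 1
    rw [← lintegral_sub_left_eq_self (fun y => ‖κ₂ y‖ₑ ^ (2 : ℝ)) w]
    refine lintegral_congr fun y => ?_
    rw [Real.enorm_eq_ofReal (Set.indicator_nonneg (fun z _ => kap_nonneg z) _)]
  · exact (eLpNorm_two_eq_lintegral g).symm

/-- **Near part, sup bound**: for `|θ| ≤ b`, `∫ |θ(z)| κ₁(w - z) dz ≤ b ‖κ₁‖_{L¹}` for every `w`. [folklore] -/
private theorem lintegral_theta_kapNear_le {θ : EuclideanSpace ℝ (Fin 3) → ℝ} {b : ℝ}
    (hθ : ∀ z, |θ z| ≤ b) (w : EuclideanSpace ℝ (Fin 3)) :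
    ∫⁻ z, ENNReal.ofReal |θ z| * ENNReal.ofReal ((ball (0 : EuclideanSpace ℝ (Fin 3)) 1).indicator (fun z : EuclideanSpace ℝ (Fin 3) => (4 * π * ‖z‖ ^ 2)⁻¹) (w - z)) ≤
      ENNReal.ofReal b * ∫⁻ z, ‖(ball (0 : EuclideanSpace ℝ (Fin 3)) 1).indicator (fun z : EuclideanSpace ℝ (Fin 3) => (4 * π * ‖z‖ ^ 2)⁻¹) z‖ₑ := by
  set κ₁ := (ball (0 : EuclideanSpace ℝ (Fin 3)) 1).indicator (fun z : EuclideanSpace ℝ (Fin 3) => (4 * π * ‖z‖ ^ 2)⁻¹) with hκ₁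
  calc ∫⁻ z, ENNReal.ofReal |θ z| * ENNReal.ofReal (κ₁ (w - z))
      ≤ ∫⁻ z, ENNReal.ofReal b * ENNReal.ofReal (κ₁ (w - z)) :=
        lintegral_mono fun z => mul_le_mul' (ENNReal.ofReal_le_ofReal (hθ z)) le_rfl
    _ = ENNReal.ofReal b * ∫⁻ z, ENNReal.ofReal (κ₁ (w - z)) :=
        lintegral_const_mul' _ _ ENNReal.ofReal_ne_top
    _ = ENNReal.ofReal b * ∫⁻ z, ‖κ₁ z‖ₑ := by
        rw [← lintegral_sub_left_eq_self (fun z => ‖κ₁ z‖ₑ) w]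
        congr 1
        refine lintegral_congr fun z => ?_
        rw [Real.enorm_eq_ofReal (Set.indicator_nonneg (fun z _ => kap_nonneg z) _)]

/-- **Near part, support**: if `θ` vanishes off `B̄(0, ρ)` and `|w| > ρ + 1`, then
`∫ |θ(z)| κ₁(w - z) dz = 0` (`κ₁` lives on the unit ball). [folklore] -/
private theorem lintegral_theta_kapNear_eq_zero {θ : EuclideanSpace ℝ (Fin 3) → ℝ} {ρ : ℝ}
    (hθ0 : ∀ z, ρ < ‖z‖ → θ z = 0) {w : EuclideanSpace ℝ (Fin 3)} (hw : ρ + 1 < ‖w‖) :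
    ∫⁻ z, ENNReal.ofReal |θ z| * ENNReal.ofReal ((ball (0 : EuclideanSpace ℝ (Fin 3)) 1).indicator (fun z : EuclideanSpace ℝ (Fin 3) => (4 * π * ‖z‖ ^ 2)⁻¹) (w - z)) = 0 := by
  refine (lintegral_congr fun z => ?_).trans lintegral_zero
  by_cases hz : ρ < ‖z‖
  · rw [hθ0 z hz, abs_zero, ENNReal.ofReal_zero, zero_mul]
  · have hwz : w - z ∉ ball (0 : EuclideanSpace ℝ (Fin 3)) 1 := by
      rw [mem_ball_zero_iff, not_lt]
      have := norm_sub_norm_le w z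
      push Not at hz
      linarith [norm_sub_rev w z]
    rw [indicator_of_notMem hwz, ENNReal.ofReal_zero, mul_zero]

/-- **Bound for the force-potential probe term** (Tao 2011, §4, proof of Lemma 4.1 (i): the term
`R⁻³ ∫ fᵢ (∇Δ⁻¹∂ᵢχ)(x/R)`, "`O(R^{-3/2} ‖f‖_{L²})` by the finite energy of the data"): for
`g : ℝ³ → ℝ³` continuous with `‖g‖_{L²} ≤ F`, every `R ≥ 1`, centre `x₀` and direction `a`,
`|∫ ∂ₐχ_R(z) (Δ⁻¹∇·g)(x₀ - z) dz| ≤ K F R⁻¹`. Proof: `|Δ⁻¹∇·g| ≤ κ ⋆ |g|`, `κ = κ₁ + κ₂`; the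
near part by `|∂ₐχ_R| ⋆ κ₁ ≤ ‖κ₁‖₁ sup|∂ₐχ_R| = O(R⁻⁴)` on `B̄(x₀, 2R + 1)` and Cauchy–Schwarz
there (`O(R^{-5/2})`), the far part by Tonelli and `∫ κ₂(w - y)|g| ≤ ‖κ₂‖₂‖g‖₂`,
`‖∂ₐχ_R‖₁ = O(R⁻¹)`. [cite: Tao2011, §4, proof of Lemma 4.1 (i)] -/
theorem exists_bound_probe_forcePotential (a : EuclideanSpace ℝ (Fin 3)) : ∃ K, 0 ≤ K ∧
    ∀ (g : EuclideanSpace ℝ (Fin 3) → EuclideanSpace ℝ (Fin 3)) (F : ℝ), Continuous g → 0 ≤ F →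
    eLpNorm g 2 volume ≤ ENNReal.ofReal F → ∀ (R : ℝ), 1 ≤ R → ∀ x₀ : EuclideanSpace ℝ (Fin 3),
      |∫ z, fderiv ℝ (probeBump R) z a * forcePotential g (x₀ - z)| ≤ K * F * R⁻¹ := by
  obtain ⟨⟨C₁, hC₁⟩, -⟩ := exists_bound_baseBump_derivs (E := EuclideanSpace ℝ (Fin 3))
  have hC₁0 : 0 ≤ C₁ := (norm_nonneg _).trans (hC₁ 0)
  set m := baseBumpMass (EuclideanSpace ℝ (Fin 3)) with hm
  have hm0 : 0 < m := baseBumpMass_pos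
  set V₁ := (volume : Measure (EuclideanSpace ℝ (Fin 3))).real (closedBall (0 : EuclideanSpace ℝ (Fin 3)) 1) with hV₁
  have hV₁0 : 0 ≤ V₁ := measureReal_nonneg
  -- the two kernel constants
  set κ₁ := (ball (0 : EuclideanSpace ℝ (Fin 3)) 1).indicator (fun z : EuclideanSpace ℝ (Fin 3) => (4 * π * ‖z‖ ^ 2)⁻¹) with hκ₁
  set κ₂ := (ball (0 : EuclideanSpace ℝ (Fin 3)) 1)ᶜ.indicator (fun z : EuclideanSpace ℝ (Fin 3) => (4 * π * ‖z‖ ^ 2)⁻¹) with hκ₂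
  have hκ₁m : Measurable κ₁ := measurable_kap.indicator measurableSet_ball
  have hκ₂m : Measurable κ₂ := measurable_kap.indicator measurableSet_ball.compl
  set K₁ := (∫⁻ z, ‖κ₁ z‖ₑ).toReal with hK₁
  set K₂ := (eLpNorm κ₂ 2 volume).toReal with hK₂
  have hK₁0 : 0 ≤ K₁ := ENNReal.toReal_nonneg
  have hK₂0 : 0 ≤ K₂ := ENNReal.toReal_nonneg
  have hK₁e : ∫⁻ z, ‖κ₁ z‖ₑ = ENNReal.ofReal K₁ := (ENNReal.ofReal_toReal integrable_kap_near.2.ne).symm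
  have hK₂e : eLpNorm κ₂ 2 volume = ENNReal.ofReal K₂ := (ENNReal.ofReal_toReal memLp_kap_far.eLpNorm_ne_top).symm
  refine ⟨C₁ * ‖a‖ * m⁻¹ * (K₁ * Real.sqrt (27 * V₁) + 8 * V₁ * K₂), by positivity, ?_⟩
  intro g F hg hF hgF R hR1 x₀
  have hR : 0 < R := one_pos.trans_le hR1
  have hd : Module.finrank ℝ (EuclideanSpace ℝ (Fin 3)) = 3 := finrank_euclideanSpace_fin
  -- the test function `θ = ∂ₐχ_R`: bound and support
  set θ : EuclideanSpace ℝ (Fin 3) → ℝ := fun z => fderiv ℝ (probeBump R) z a with hθ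
  set b : ℝ := (m * R ^ 3)⁻¹ * R⁻¹ * C₁ * ‖a‖ with hb
  have hb0 : 0 ≤ b := by positivity
  have hθb : ∀ z, |θ z| ≤ b := fun z => by
    have h1 := norm_fderiv_probeBump_le (E := EuclideanSpace ℝ (Fin 3)) hR hC₁ z
    rw [hd, ← hm] at h1
    calc |θ z| = ‖fderiv ℝ (probeBump R) z a‖ := (Real.norm_eq_abs _).symm
      _ ≤ ‖fderiv ℝ (probeBump R) z‖ * ‖a‖ := ContinuousLinearMap.le_opNorm _ _
      _ ≤ (m * R ^ 3)⁻¹ * R⁻¹ * C₁ * ‖a‖ := mul_le_mul_of_nonneg_right h1 (norm_nonneg _)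
  have hθ0 : ∀ z, 2 * R < ‖z‖ → θ z = 0 := fun z hz => by
    have hz' : z ∉ tsupport (fderiv ℝ (probeBump (E := EuclideanSpace ℝ (Fin 3)) R)) := fun h =>
      not_le.2 hz (mem_closedBall_zero_iff.1 (tsupport_probeBump_subset hR (tsupport_fderiv_subset ℝ h)))
    simp [hθ, image_eq_zero_of_notMem_tsupport hz']
  have hθc : Continuous θ :=
    ((contDiff_probeBump (E := EuclideanSpace ℝ (Fin 3)) R (n := 1)).continuous_fderiv (by simp)).clm_apply
      continuous_const
  have hθm : Measurable fun z => ENNReal.ofReal |θ z| :=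
    ENNReal.measurable_ofReal.comp (continuous_abs.comp hθc).measurable
  -- Step 1: `‖G‖ₑ ≤ ∫∫ |θ z| κ(x₀ - z - y) |g y|`
  have hgm : Measurable g := hg.measurable
  have hm1 : ∀ z, Measurable fun y => ENNReal.ofReal (κ₁ (x₀ - z - y)) * ‖g y‖ₑ := fun z =>
    (ENNReal.measurable_ofReal.comp (hκ₁m.comp (measurable_const.sub measurable_id))).mul hgm.enorm
  have hm2 : ∀ y, Measurable fun z => ENNReal.ofReal |θ z| * ENNReal.ofReal (κ₁ (x₀ - y - z)) := fun y =>
    hθm.mul (ENNReal.measurable_ofReal.comp (hκ₁m.comp (measurable_const.sub measurable_id)))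
  have hFu : Measurable (Function.uncurry fun z y : EuclideanSpace ℝ (Fin 3) =>
      ENNReal.ofReal (κ₁ (x₀ - z - y)) * ‖g y‖ₑ) :=
    (ENNReal.measurable_ofReal.comp (hκ₁m.comp
      ((measurable_const.sub measurable_fst).sub measurable_snd))).mul (hgm.comp measurable_snd).enorm
  have hm3 : Measurable fun z => ENNReal.ofReal |θ z| * ∫⁻ y, ENNReal.ofReal (κ₁ (x₀ - z - y)) * ‖g y‖ₑ :=
    hθm.mul (Measurable.lintegral_prod_right
      (f := fun z y : EuclideanSpace ℝ (Fin 3) => ENNReal.ofReal (κ₁ (x₀ - z - y)) * ‖g y‖ₑ) hFu)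
  have step1 : ‖∫ z, θ z * forcePotential g (x₀ - z)‖ₑ ≤
      ∫⁻ z, ENNReal.ofReal |θ z| * ∫⁻ y, ENNReal.ofReal ((4 * π * ‖x₀ - z - y‖ ^ 2)⁻¹) * ‖g y‖ₑ := by
    refine (enorm_integral_le_lintegral_enorm _).trans (lintegral_mono fun z => ?_)
    rw [enorm_mul, Real.enorm_eq_ofReal_abs]
    exact mul_le_mul' le_rfl (enorm_forcePotential_le g (x₀ - z))
  -- Step 2: split `κ = κ₁ + κ₂` inside
  have split : ∀ z, ∫⁻ y, ENNReal.ofReal ((4 * π * ‖x₀ - z - y‖ ^ 2)⁻¹) * ‖g y‖ₑ =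
      (∫⁻ y, ENNReal.ofReal (κ₁ (x₀ - z - y)) * ‖g y‖ₑ) + ∫⁻ y, ENNReal.ofReal (κ₂ (x₀ - z - y)) * ‖g y‖ₑ := by
    intro z
    rw [← lintegral_add_left (hm1 z)]
    refine lintegral_congr fun y => ?_
    rw [← add_mul, kap_eq_near_add_far (x₀ - z - y), ENNReal.ofReal_add
      (Set.indicator_nonneg (fun w _ => kap_nonneg w) _) (Set.indicator_nonneg (fun w _ => kap_nonneg w) _)]
  -- Step 3: the far part
  have far : ∫⁻ z, ENNReal.ofReal |θ z| * ∫⁻ y, ENNReal.ofReal (κ₂ (x₀ - z - y)) * ‖g y‖ₑ ≤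
      ENNReal.ofReal (b * (8 * R ^ 3 * V₁)) * (ENNReal.ofReal K₂ * eLpNorm g 2 volume) := by
    calc ∫⁻ z, ENNReal.ofReal |θ z| * ∫⁻ y, ENNReal.ofReal (κ₂ (x₀ - z - y)) * ‖g y‖ₑ
        ≤ ∫⁻ z, ENNReal.ofReal |θ z| * (eLpNorm κ₂ 2 volume * eLpNorm g 2 volume) :=
          lintegral_mono fun z => mul_le_mul' le_rfl (lintegral_kapFar_mul_le hg.aestronglyMeasurable _)
      _ = (∫⁻ z, ENNReal.ofReal |θ z|) * (eLpNorm κ₂ 2 volume * eLpNorm g 2 volume) :=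
          lintegral_mul_const _ hθm
      _ ≤ ENNReal.ofReal (b * (8 * R ^ 3 * V₁)) * (ENNReal.ofReal K₂ * eLpNorm g 2 volume) := by
          rw [hK₂e]
          gcongr
          -- `‖θ‖₁ ≤ b · vol B̄(0, 2R)`
          calc ∫⁻ z, ENNReal.ofReal |θ z|
              ≤ ∫⁻ z, (closedBall (0 : EuclideanSpace ℝ (Fin 3)) (2 * R)).indicator (fun _ => ENNReal.ofReal b) z := by
                refine lintegral_mono fun z => ?_
                by_cases hz : z ∈ closedBall (0 : EuclideanSpace ℝ (Fin 3)) (2 * R)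
                · rw [indicator_of_mem hz]; exact ENNReal.ofReal_le_ofReal (hθb z)
                · rw [indicator_of_notMem hz, hθ0 z (by rwa [mem_closedBall_zero_iff, not_le] at hz),
                    abs_zero, ENNReal.ofReal_zero]
            _ = ENNReal.ofReal b * volume (closedBall (0 : EuclideanSpace ℝ (Fin 3)) (2 * R)) := by
                rw [lintegral_indicator measurableSet_closedBall, setLIntegral_const]
            _ = ENNReal.ofReal (b * (8 * R ^ 3 * V₁)) := by
                rw [← ofReal_measureReal (measure_closedBall_lt_top).ne,
                  volume_real_closedBall_two_mul 0 hR.le, ← hV₁, ENNReal.ofReal_mul hb0]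
  -- Step 4: the near part (Tonelli, sup bound, support, Cauchy–Schwarz on `B̄(x₀, 2R + 1)`)
  set B := closedBall x₀ (2 * R + 1) with hB
  have hBm : MeasurableSet B := measurableSet_closedBall
  have near : ∫⁻ z, ENNReal.ofReal |θ z| * ∫⁻ y, ENNReal.ofReal (κ₁ (x₀ - z - y)) * ‖g y‖ₑ ≤
      ENNReal.ofReal (b * K₁) * (volume B ^ (1 / 2 : ℝ) * eLpNorm g 2 volume) := by
    have hFm : Measurable (Function.uncurry fun z y : EuclideanSpace ℝ (Fin 3) =>
        ENNReal.ofReal |θ z| * (ENNReal.ofReal (κ₁ (x₀ - z - y)) * ‖g y‖ₑ)) := by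
      refine (hθm.comp measurable_fst).mul ((ENNReal.measurable_ofReal.comp (hκ₁m.comp ?_)).mul
        (hgm.comp measurable_snd).enorm)
      exact (measurable_const.sub measurable_fst).sub measurable_snd
    calc ∫⁻ z, ENNReal.ofReal |θ z| * ∫⁻ y, ENNReal.ofReal (κ₁ (x₀ - z - y)) * ‖g y‖ₑ
        = ∫⁻ z, ∫⁻ y, ENNReal.ofReal |θ z| * (ENNReal.ofReal (κ₁ (x₀ - z - y)) * ‖g y‖ₑ) := by
          refine lintegral_congr fun z => ?_
          rw [lintegral_const_mul' _ _ ENNReal.ofReal_ne_top]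
      _ = ∫⁻ y, ∫⁻ z, ENNReal.ofReal |θ z| * (ENNReal.ofReal (κ₁ (x₀ - z - y)) * ‖g y‖ₑ) :=
          lintegral_lintegral_swap hFm.aemeasurable
      _ = ∫⁻ y, (∫⁻ z, ENNReal.ofReal |θ z| * ENNReal.ofReal (κ₁ ((x₀ - y) - z))) * ‖g y‖ₑ := by
          refine lintegral_congr fun y => ?_
          rw [← lintegral_mul_const _ (hm2 y)]
          refine lintegral_congr fun z => ?_
          rw [sub_right_comm, mul_assoc]
      _ ≤ ∫⁻ y, B.indicator (fun y => ENNReal.ofReal (b * K₁) * ‖g y‖ₑ) y := by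
          refine lintegral_mono fun y => ?_
          by_cases hy : y ∈ B
          · rw [indicator_of_mem hy, ENNReal.ofReal_mul hb0, ← hK₁e]
            exact mul_le_mul' (lintegral_theta_kapNear_le hθb _) le_rfl
          · have hy' : 2 * R + 1 < ‖x₀ - y‖ := by
              rw [hB, mem_closedBall, dist_eq_norm, not_le, ← norm_neg, neg_sub] at hy; exact hy
            rw [indicator_of_notMem hy, lintegral_theta_kapNear_eq_zero hθ0 hy', zero_mul]
      _ = ENNReal.ofReal (b * K₁) * ∫⁻ y in B, ‖g y‖ₑ := by
          rw [← lintegral_indicator hBm, ← lintegral_const_mul' _ _ ENNReal.ofReal_ne_top]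
          refine lintegral_congr fun y => ?_
          by_cases hy : y ∈ B <;> simp [hy]
      _ ≤ ENNReal.ofReal (b * K₁) * (volume B ^ (1 / 2 : ℝ) * eLpNorm g 2 volume) :=
          mul_le_mul' le_rfl (setLIntegral_enorm_le_sqrt_volume_mul_eLpNorm hg.aestronglyMeasurable hBm)
  -- the volume of `B̄(x₀, 2R + 1) ⊆ B̄(x₀, 3R)`
  have hvolB : volume B ^ (1 / 2 : ℝ) ≤ ENNReal.ofReal (Real.sqrt (27 * V₁) * R * Real.sqrt R) := by
    have hsub : B ⊆ closedBall x₀ (3 * R) := closedBall_subset_closedBall (by linarith)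
    have h1 : volume B ≤ ENNReal.ofReal (27 * R ^ 3 * V₁) := by
      refine (measure_mono hsub).trans (le_of_eq ?_)
      rw [← ofReal_measureReal (measure_closedBall_lt_top).ne, Measure.addHaar_real_closedBall' volume x₀
        (by positivity : (0 : ℝ) ≤ 3 * R), hd, ← hV₁]
      ring_nf
    calc volume B ^ (1 / 2 : ℝ) ≤ ENNReal.ofReal (27 * R ^ 3 * V₁) ^ (1 / 2 : ℝ) := by gcongr
      _ = ENNReal.ofReal (Real.sqrt (27 * R ^ 3 * V₁)) := by
          rw [Real.sqrt_eq_rpow, ENNReal.ofReal_rpow_of_nonneg (by positivity) (by norm_num)]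
      _ = ENNReal.ofReal (Real.sqrt (27 * V₁) * R * Real.sqrt R) := by
          congr 1
          rw [show 27 * R ^ 3 * V₁ = (27 * V₁) * (R ^ 2 * R) by ring,
            Real.sqrt_mul (by positivity : (0 : ℝ) ≤ 27 * V₁),
            Real.sqrt_mul (by positivity : (0 : ℝ) ≤ R ^ 2), Real.sqrt_sq hR.le]
          ring
  -- Step 5: assemble in `ℝ≥0∞`, then read out
  have hgF' : eLpNorm g 2 volume ≤ ENNReal.ofReal F := hgF
  have total : ‖∫ z, θ z * forcePotential g (x₀ - z)‖ₑ ≤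
      ENNReal.ofReal (b * K₁ * (Real.sqrt (27 * V₁) * R * Real.sqrt R) * F +
        b * (8 * R ^ 3 * V₁) * (K₂ * F)) := by
    refine step1.trans ?_
    simp_rw [split]
    rw [show (fun z => ENNReal.ofReal |θ z| * ((∫⁻ y, ENNReal.ofReal (κ₁ (x₀ - z - y)) * ‖g y‖ₑ) +
        ∫⁻ y, ENNReal.ofReal (κ₂ (x₀ - z - y)) * ‖g y‖ₑ)) = fun z =>
        ENNReal.ofReal |θ z| * (∫⁻ y, ENNReal.ofReal (κ₁ (x₀ - z - y)) * ‖g y‖ₑ) +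
          ENNReal.ofReal |θ z| * ∫⁻ y, ENNReal.ofReal (κ₂ (x₀ - z - y)) * ‖g y‖ₑ from
        funext fun z => mul_add _ _ _]
    rw [lintegral_add_left hm3]
    rw [ENNReal.ofReal_add (by positivity) (by positivity),
      ENNReal.ofReal_mul (p := b * K₁ * (Real.sqrt (27 * V₁) * R * Real.sqrt R)) (by positivity),
      ENNReal.ofReal_mul (p := b * K₁) (by positivity),
      ENNReal.ofReal_mul (p := b * (8 * R ^ 3 * V₁)) (by positivity),
      ENNReal.ofReal_mul (p := K₂) hK₂0]
    refine add_le_add (near.trans ?_) (far.trans ?_)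
    · exact (mul_le_mul' le_rfl (mul_le_mul' hvolB hgF')).trans_eq (mul_assoc _ _ _).symm
    · exact mul_le_mul' le_rfl (mul_le_mul' le_rfl hgF')
  have habs := abs_le_of_enorm_le (by positivity) total
  refine habs.trans ?_
  -- arithmetic for `R ≥ 1`
  have hsqrtR : Real.sqrt R ≤ R :=
    calc Real.sqrt R ≤ Real.sqrt (R ^ 2) := Real.sqrt_le_sqrt (by nlinarith)
      _ = R := Real.sqrt_sq hR.le
  have e1 : b * K₁ * (Real.sqrt (27 * V₁) * R * Real.sqrt R) * F =
      C₁ * ‖a‖ * m⁻¹ * (K₁ * Real.sqrt (27 * V₁)) * F * R⁻¹ * (Real.sqrt R * R⁻¹ ^ 2) := by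
    rw [hb]; field_simp
  have e2 : b * (8 * R ^ 3 * V₁) * (K₂ * F) = C₁ * ‖a‖ * m⁻¹ * (8 * V₁ * K₂) * F * R⁻¹ := by
    rw [hb]; field_simp
  have hsmall : Real.sqrt R * R⁻¹ ^ 2 ≤ 1 := by
    calc Real.sqrt R * R⁻¹ ^ 2 ≤ R * R⁻¹ ^ 2 := by gcongr
      _ = R⁻¹ := by field_simp
      _ ≤ 1 := inv_le_one_of_one_le₀ hR1
  rw [e1, e2]
  have hA : 0 ≤ C₁ * ‖a‖ * m⁻¹ * (K₁ * Real.sqrt (27 * V₁)) * F * R⁻¹ := by positivity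
  calc C₁ * ‖a‖ * m⁻¹ * (K₁ * Real.sqrt (27 * V₁)) * F * R⁻¹ * (Real.sqrt R * R⁻¹ ^ 2) +
        C₁ * ‖a‖ * m⁻¹ * (8 * V₁ * K₂) * F * R⁻¹
      ≤ C₁ * ‖a‖ * m⁻¹ * (K₁ * Real.sqrt (27 * V₁)) * F * R⁻¹ * 1 +
        C₁ * ‖a‖ * m⁻¹ * (8 * V₁ * K₂) * F * R⁻¹ := by gcongr
    _ = C₁ * ‖a‖ * m⁻¹ * (K₁ * Real.sqrt (27 * V₁) + 8 * V₁ * K₂) * F * R⁻¹ := by ring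

end PotentialTerm

end Literature.Analysis.FluidPDE

end
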